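import Summits.Ventures.PercRepro0.ChiLower
import Summits.Ventures.PercRepro0.BubbleClose

/-!
# PM-D · CHI-LOWER, closed: BK discharged by `Bubble.BK_holds` (seat p2, block-M census evidence)

The three statements of `ChiLower.lean` with the hypothesis `hBK : Bubble.BK d` discharged by `Bubble.BK_holds`
(BubbleClose, from p2's `BK.P_disjointOcc_le`): PM-D · CHI-LOWER (census v7 §3.4) is kernel-checked on the
cell's definitions with NO hypothesis. A LOWER bound on `χ` below `p_c(d)`: census evidence only, off every
declaration path, not a door, not a status change; NOTHING here asserts anything about `B_q`, `∫ B_q dq` or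
`T(d)` for any `3 ≤ d ≤ 10`.
-/

namespace Summit.Ventures.PercRepro0.ChiLower

open MeasureTheory unitInterval Set
open Summit.Ventures.PercRepro0.Defs
open Summit.Ventures.PercRepro0.PcChi (chi)
open scoped ENNReal

variable {d : ℕ}

/-- **PM-D · CHI-LOWER, real form, no hypothesis** (`d ≥ 1`): `1/(2d (p_c(d) − q)) ≤ χ_d(q)` for `0 ≤ q < p_c(d)`. -/
theorem inv_le_chi_toReal' (hd : 1 ≤ d) {q : ℝ} (hq0 : 0 ≤ q) (hq : q < pc d) :
    1 / (2 * d * (pc d - q)) ≤ (chi d (clamp q)).toReal :=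
  inv_le_chi_toReal hd (Bubble.BK_holds d) hq0 hq

/-- **PM-D · CHI-LOWER, no hypothesis** (census v7 §3.4; `d ≥ 1`): for every `q ∈ [0, p_c(d))`,
`ENNReal.ofReal (1/(2d (p_c(d) − q))) ≤ χ_d(q)`. -/
theorem chi_lower' (hd : 1 ≤ d) {q : ℝ} (hq0 : 0 ≤ q) (hq : q < pc d) :
    ENNReal.ofReal (1 / (2 * d * (pc d - q))) ≤ chi d (clamp q) :=
  chi_lower hd (Bubble.BK_holds d) hq0 hq

/-- **Corollary, no hypothesis** (`d ≥ 1`): `∫_p^{p_c(d)} χ_d(q) dq = ∞` for every `0 ≤ p < p_c(d)`. -/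
theorem lintegral_chi_eq_top' (hd : 1 ≤ d) {p : ℝ} (hp0 : 0 ≤ p) (hp : p < pc d) :
    ∫⁻ q in Set.Ioc p (pc d), chi d (clamp q) = ⊤ :=
  lintegral_chi_eq_top hd (Bubble.BK_holds d) hp0 hp

end Summit.Ventures.PercRepro0.ChiLower
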